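import Summits.CriticalPhenomena.PercolationContinuityZ3.Theorems.Transplant.SkelNegBParamsSlotsF
import Summits.CriticalPhenomena.PercolationContinuityZ3.Theorems.Transplant.SkelNegBParamsSlotsT
import Summits.CriticalPhenomena.PercolationContinuityZ3.Theorems.Transplant.SkelNegBParamsSchedA
import HarnessLib

/-!
# N1 params, chain of record `NegB`, part Residuals-A — THE RESIDUAL SLOT VALUES OF THE (ζ′) TUPLE (FEASIBILITY §ζ′, p3-g11 02:53:30Z (1) ✓): the bridge count
# **`cFA := 1000·Kq + 1`** (the wide y′-face bridge `PxF cFA`), the `L′/E₀` residual **`NegB.exA := exR2 + Kq·(Yb + 1000·U + 11055·n_L + 1000·ℓ_L + 20) + exCA`**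
# (`exCA := 4 + 13·(20K·(n_L + Q_w))`, the (C) `E₀`-floor with `800 ↦ A`; every floor of `exR2` re-served, the `×Kq` reach floors added), the excess-diameter residual
# **`NegB.mxRA := ⌈prFA.mF fcellsA⌉₊`**, the width residual **`KS.fxA := 2400·Kq·(RA′+2)`** (p3's root count `n_L ≥ 2(N+1)(RA′+2)` at `N ≤ 1000·Kq`), the box residual
# **`KS.gxA c := max (gxF c) (30000·Kq·(RA′+2))`** (the y′-face `hW` at ×Kq recession; keeps `64·S_R`, `64·S_F`), and THE FLOORS AT THESE VALUES by name
# (stmt-g16 2026-08-22; NEG-SCOPE §B.19 (ζ′))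
The NOWL tuple of record (values as they land): `negChoiceAllOTA (KS.gT 0 (KS.gxA cFA)) (KS.fT 0 KS.fxA) (KS.PR 0 (KS.PxF cFA 0)) (SUA exA mxRA)`.
Reused unchanged (cell-free): `Rl`, `Rb`, `Yb`, `exC`, `exR`, `exR2`, `floors_exR2`, `gxR2`, `gxF`, `SF`, `PxF`, `gT/fT` and their floors.
builds on p205010 (kernel theorem, internal audit signed; external expert review pending) — nothing in this file uses p205010; NOTHING is claimed about the node
`SamePDropOfSkeletonNeg₁` (OPEN).
Lane `prim-bschramm-*`, seat `prim-bschramm-stmt` (gen 16); helper file (`--supports stmt-CriticalPhenomena-4575 --as helper`); ledger HOME/prim-bschramm-stmt/NEG-PARAMS.md.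
* §1 **`cFA`**, `cFA_eq`, **`exCA`**, `exC_le_exCA`, **`exA`**, `exR2_le_exA`, **`floors_exA`**, `floorsK_exA` (the `×Kq` floors), **`hex_exA_at`/`hex_exA`** (the (C) binder shape
  with `800 ↦ 20K`), **`mxRA`**, `mF_le_mxRA`; §2 **`KS.fxA`**, **`KS.gxA`**, `fxA_at/gxA_at`, **`nL_floorsA`** (`2400·Kq·(RA′+2) ≤ n_L`, …), **`ML_floorsA`**
  (`30000·Kq·(RA′+2) ≤ M_L`, `64·S_R ≤ M_L`, `64·S_F ≤ M_L`, `16·S_F ≤ M_L`).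
[cite: KozmaNitzan2024, §4 Theorem 6 (pp. 25–31): the order of constants]
-/

noncomputable section

open scoped Classical

namespace Summit.CriticalPhenomena.PercolationContinuityZ3.Theorems.Transplant

namespace PlanarSkeletonNeg

namespace NegB

open Literature.Probability.Percolation Literature.Probability.LatticeModels SimpleGraph
open SkelConc (Consts)
open Skelφ (shearUnit)
open Skelφ.StepI (DataN)
open Neg

/-! ## §1 The bridge count, the `L′/E₀` residual and the excess-diameter residual -/

/-- **THE WIDE y′-FACE BRIDGE COUNT OF THE (ζ′) TUPLE** `cFA := 1000·Kq + 1` (p3-g11 01:45:32Z (1): `c := 1000·Kq + 1` under (ζ′)). [this work] -/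
def cFA (κ : Consts) : ℕ := 1000 * Neg.Kq κ + 1

/-- `cFA = 1000·Kq + 1` and `1001 ≤ cFA`. [folklore] -/
theorem cFA_eq (κ : Consts) : cFA κ = 1000 * Neg.Kq κ + 1 ∧ 1001 ≤ cFA κ := by
  have := Neg.one_le_Kq κ; unfold cFA; constructor <;> omega

section Values

variable (κ : Consts) {V : Type} [DecidableEq V] [Countable V] {G : SimpleGraph V} [G.LocallyFinite] (Φ : PlanarSkeletonNeg G) (t : V)
  (p : unitInterval) (D : DataN V) (g f : ℕ)

/-- The (C) `E₀`-floor with `800 ↦ A = 20K`: `exCA := 4 + 13·(20K·(n_L + Q_w))`. [this work] -/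
def exCA : ℕ := 4 + 13 * (20 * Neg.K κ * (nL κ Φ t p D g f + KS.Wrun κ Φ t p D g f))

/-- `exC ≤ exCA` (`800 ≤ 20K`). [folklore] -/
theorem exC_le_exCA : exC κ Φ t p D g f ≤ exCA κ Φ t p D g f := by
  have hK := (Neg.forty_le_K κ).1
  unfold exC exCA
  have : 800 * (nL κ Φ t p D g f + KS.Wrun κ Φ t p D g f) ≤ 20 * Neg.K κ * (nL κ Φ t p D g f + KS.Wrun κ Φ t p D g f) := by
    have : 800 ≤ 20 * Neg.K κ := by omega
    exact Nat.mul_le_mul_right _ this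
  omega

end Values

/-- **THE `L′/E₀` RESIDUAL OF THE (ζ′) TUPLE** `exA := exR2 + Kq·(Yb + 1000·U + 11055·n_L + 1000·ℓ_L + 20) + exCA`. [this work] -/
def exA : GSlot := fun κ _ _ _ _ _ Φ t p D g f =>
  exR2 κ Φ t p D g f + Neg.Kq κ * (Yb κ Φ t p D g f + 1000 * shearUnit (nL κ Φ t p D g f) (hL κ Φ t p D g f) + 11055 * nL κ Φ t p D g f + 1000 * ℓL κ Φ t p D g f + 20) +
    exCA κ Φ t p D g f

/-- **THE EXCESS-DIAMETER RESIDUAL OF THE (ζ′) TUPLE** `mxRA := ⌈prFA.mF fcellsA⌉₊`. [this work] -/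
def mxRA : GSlot := fun κ _ _ _ _ _ Φ t p D g f => ((prFA κ Φ t p D g f).mF (fcellsA κ Φ t p D g f)).toNat

section ExFacts

variable (κ : Consts) {V : Type} [DecidableEq V] [Countable V] {G : SimpleGraph V} [G.LocallyFinite] (Φ : PlanarSkeletonNeg G) (t : V)
  (p : unitInterval) (D : DataN V) (g f : ℕ)

/-- `exR2 ≤ exA`, `exCA ≤ exA`. [folklore] -/
theorem exR2_le_exA : exR2 κ Φ t p D g f ≤ exA κ Φ t p D g f ∧ exCA κ Φ t p D g f ≤ exA κ Φ t p D g f := by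
  unfold exA; constructor <;> omega

/-- **Every `exR2`-floor at `exA`** (the record's floors re-served). [folklore] -/
theorem floors_exA :
    KS.r₀A Φ t D 0 (Rb κ Φ t p D) + 1 ≤ exA κ Φ t p D g f ∧ KS.r₀A Φ t D 0 (Rl κ Φ t p D g f) + 1 ≤ exA κ Φ t p D g f ∧
    Rl κ Φ t p D g f + 1 ≤ exA κ Φ t p D g f ∧ Rb κ Φ t p D + 1 ≤ exA κ Φ t p D g f ∧
    Yb κ Φ t p D g f + 1000 * shearUnit (nL κ Φ t p D g f) (hL κ Φ t p D g f) + 1 ≤ exA κ Φ t p D g f ∧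
    exC κ Φ t p D g f ≤ exA κ Φ t p D g f ∧ KS.RlevA κ Φ t p D 0 + KS.reachA t D 0 ≤ exA κ Φ t p D g f ∧
    KS.r₀A Φ t D 0 (Rl κ Φ t p D g f) ≤ exA κ Φ t p D g f ∧ Yb κ Φ t p D g f + 11055 * nL κ Φ t p D g f + 1000 * ℓL κ Φ t p D g f + 20 ≤ exA κ Φ t p D g f := by
  have h := floors_exR2 κ Φ t p D g f
  have h2 := (exR2_le_exA κ Φ t p D g f).1
  have h3 := (exR_le_exR2 κ Φ t p D g f).2
  omega

/-- **THE `×Kq` FLOORS at `exA`**: `Yb + 1000·Kq·U + 1 ≤ exA`, `Kq·(Yb + 11055 n_L + 1000 ℓ_L + 20) ≤ exA` (the x-run's `1000·Kq` levels, the y′-leg's reach at `×Kq`),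
`exCA ≤ exA`. [folklore] -/
theorem floorsK_exA :
    Yb κ Φ t p D g f + 1000 * Neg.Kq κ * shearUnit (nL κ Φ t p D g f) (hL κ Φ t p D g f) + 1 ≤ exA κ Φ t p D g f ∧
      Neg.Kq κ * (Yb κ Φ t p D g f + 11055 * nL κ Φ t p D g f + 1000 * ℓL κ Φ t p D g f + 20) ≤ exA κ Φ t p D g f ∧
      Neg.Kq κ * (Yb κ Φ t p D g f + 1000 * shearUnit (nL κ Φ t p D g f) (hL κ Φ t p D g f) + 11055 * nL κ Φ t p D g f + 1000 * ℓL κ Φ t p D g f + 20) ≤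
        exA κ Φ t p D g f ∧
      exCA κ Φ t p D g f ≤ exA κ Φ t p D g f := by
  have hq := Neg.one_le_Kq κ
  have h1 := (floors_exR2 κ Φ t p D g f).2.2.2.2.1
  have e : exA κ Φ t p D g f = exR2 κ Φ t p D g f +
      Neg.Kq κ * (Yb κ Φ t p D g f + 1000 * shearUnit (nL κ Φ t p D g f) (hL κ Φ t p D g f) + 11055 * nL κ Φ t p D g f + 1000 * ℓL κ Φ t p D g f + 20) +
      exCA κ Φ t p D g f := rfl
  have hY : Yb κ Φ t p D g f ≤ Neg.Kq κ * Yb κ Φ t p D g f := Nat.le_mul_of_pos_left _ hq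
  refine ⟨?_, ?_, ?_, ?_⟩
  · rw [e, Nat.mul_add, Nat.mul_add, Nat.mul_add, Nat.mul_add]
    have : 1000 * Neg.Kq κ * shearUnit (nL κ Φ t p D g f) (hL κ Φ t p D g f) = Neg.Kq κ * (1000 * shearUnit (nL κ Φ t p D g f) (hL κ Φ t p D g f)) := by ring
    omega
  · rw [e]
    have : Neg.Kq κ * (Yb κ Φ t p D g f + 11055 * nL κ Φ t p D g f + 1000 * ℓL κ Φ t p D g f + 20) ≤
        Neg.Kq κ * (Yb κ Φ t p D g f + 1000 * shearUnit (nL κ Φ t p D g f) (hL κ Φ t p D g f) + 11055 * nL κ Φ t p D g f + 1000 * ℓL κ Φ t p D g f + 20) :=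
      Nat.mul_le_mul_left _ (by omega)
    omega
  · rw [e]; omega
  · exact (exR2_le_exA κ Φ t p D g f).2

/-- **p5's `hex` shape at `ex := exA`** with `800 ↦ 20K` (`Q_w = CorrRec.Qw`): `r₀A 0 Rl + 3 ≤ exA` and `4 + 13·(20K·(n_L + Q_w)) ≤ exA`. [folklore] -/
theorem hex_exA_at : KS.r₀A Φ t D 0 (D.R (D.scale t (ML κ Φ t p D g) (nL κ Φ t p D g f))) + 3 ≤ exA κ Φ t p D g f ∧
      4 + 13 * (20 * Neg.K κ * (nL κ Φ t p D g f + Skelφ.CorrRec.Qw (nL κ Φ t p D g f) (ℓL κ Φ t p D g f) (hL κ Φ t p D g f))) ≤ exA κ Φ t p D g f := by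
  have h := (hex_exR2_at κ Φ t p D g f).1
  have h2 := exR2_le_exA κ Φ t p D g f
  refine ⟨by omega, ?_⟩
  show 4 + 13 * (20 * Neg.K κ * (nL κ Φ t p D g f + KS.Wrun κ Φ t p D g f)) ≤ _
  exact h2.2

/-- `mF ≤ mxRA`. [folklore] -/
theorem mF_le_mxRA : (prFA κ Φ t p D g f).mF (fcellsA κ Φ t p D g f) ≤ (mxRA κ Φ t p D g f : ℤ) := by
  show _ ≤ ((Int.toNat _ : ℕ) : ℤ); exact Int.self_le_toNat _

end ExFacts

/-- **p5's `hex` at `ex := exA`, kit index `0`, any box/width residuals** (the binder shape with `800 ↦ 20K`). [folklore] -/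
theorem hex_exA (gx fx : Neg.FSlot) :
    ∀ (κ : Consts) {V : Type} [DecidableEq V] [Countable V] {G : SimpleGraph V} [G.LocallyFinite] (Φ : PlanarSkeletonNeg G) (t : V) (p : unitInterval) (D : DataN V),
      KS.r₀A Φ t D 0 (D.R (D.scale t (ML κ Φ t p D (KS.gT 0 gx κ Φ t p D)) (nL κ Φ t p D (KS.gT 0 gx κ Φ t p D) (KS.fT 0 fx κ Φ t p D)))) + 3 ≤
          exA κ Φ t p D (KS.gT 0 gx κ Φ t p D) (KS.fT 0 fx κ Φ t p D) ∧
        4 + 13 * (20 * Neg.K κ * (nL κ Φ t p D (KS.gT 0 gx κ Φ t p D) (KS.fT 0 fx κ Φ t p D) +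
          Skelφ.CorrRec.Qw (nL κ Φ t p D (KS.gT 0 gx κ Φ t p D) (KS.fT 0 fx κ Φ t p D)) (ℓL κ Φ t p D (KS.gT 0 gx κ Φ t p D) (KS.fT 0 fx κ Φ t p D))
            (hL κ Φ t p D (KS.gT 0 gx κ Φ t p D) (KS.fT 0 fx κ Φ t p D)))) ≤ exA κ Φ t p D (KS.gT 0 gx κ Φ t p D) (KS.fT 0 fx κ Φ t p D) :=
  fun κ _ _ _ _ _ Φ t p D => hex_exA_at κ Φ t p D _ _

/-! ## §2 The width and box residuals of the (ζ′) tuple and the floors at their slot values -/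

namespace KS

/-- **THE WIDTH RESIDUAL OF THE (ζ′) TUPLE** `fxA := 2400·Kq·(RA′+2)` (kit index `0`; p3's root count at `N ≤ 1000·Kq`). [this work] -/
def fxA : Neg.FSlot := fun κ _ _ _ _ _ Φ t p D => 2400 * Neg.Kq κ * (RA' κ Φ t p D 0 + 2)

/-- **THE BOX RESIDUAL OF THE (ζ′) TUPLE** `gxA c := max (gxF c) (30000·Kq·(RA′+2))` (kit index `0`; keeps `64·S_R`, `64·S_F`). [this work] -/
def gxA (c : ℕ) : Neg.FSlot := fun κ _ _ _ _ _ Φ t p D => max (gxF c κ Φ t p D) (30000 * Neg.Kq κ * (RA' κ Φ t p D 0 + 2))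

section Floors

variable (κ : Consts) {V : Type} [DecidableEq V] [Countable V] {G : SimpleGraph V} [G.LocallyFinite] (Φ : PlanarSkeletonNeg G) (t : V)
  (p : unitInterval) (D : DataN V) (c : ℕ) (g : ℕ)

/-- `fxA` and `gxA c` at `(κ, Φ, t, p, D)` (by `rfl`). [folklore] -/
theorem fxA_gxA_at : fxA κ Φ t p D = 2400 * Neg.Kq κ * (RA' κ Φ t p D 0 + 2) ∧ gxA c κ Φ t p D = max (gxF c κ Φ t p D) (30000 * Neg.Kq κ * (RA' κ Φ t p D 0 + 2)) :=
  ⟨rfl, rfl⟩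

/-- **THE LONG WIDTH's (ζ′) FLOORS AT `f := fT 0 fxA`** (any box value `g`): `2400·Kq·(RA'+2) ≤ n_L`, `2400·(RA'+2) ≤ n_L`, and the record's `2000(RA'+2) ≤ n_L`, `RA'+2 ≤ n_L`.
[folklore] -/
theorem nL_floorsA : 2400 * Neg.Kq κ * (RA' κ Φ t p D 0 + 2) ≤ nL κ Φ t p D g (fT 0 fxA κ Φ t p D) ∧ 2400 * (RA' κ Φ t p D 0 + 2) ≤ nL κ Φ t p D g (fT 0 fxA κ Φ t p D) ∧
    2000 * (RA' κ Φ t p D 0 + 2) ≤ nL κ Φ t p D g (fT 0 fxA κ Φ t p D) ∧ RA' κ Φ t p D 0 + 2 ≤ nL κ Φ t p D g (fT 0 fxA κ Φ t p D) := by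
  obtain ⟨-, h2, -, h4, h5, -⟩ := nL_floorsT κ Φ t p D 0 fxA g
  have hq := Neg.one_le_Kq κ
  have e : fxA κ Φ t p D = 2400 * Neg.Kq κ * (RA' κ Φ t p D 0 + 2) := rfl
  rw [e] at h4
  refine ⟨h4, le_trans ?_ h4, h2, h5⟩
  have : 2400 * (RA' κ Φ t p D 0 + 2) = 2400 * 1 * (RA' κ Φ t p D 0 + 2) := by ring
  rw [this]; exact Nat.mul_le_mul_right _ (Nat.mul_le_mul_left _ hq)

/-- **THE LONG BOX's (ζ′) FLOORS AT `g := gT 0 (gxA c)`**: `30000·Kq·(RA'+2) ≤ M_L`, `64·S_R ≤ M_L`, `64·S_F c ≤ M_L`, `16·S_F c ≤ M_L`, and the record's `22000(RA'+2) ≤ M_L`. [folklore] -/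
theorem ML_floorsA : 30000 * Neg.Kq κ * (RA' κ Φ t p D 0 + 2) ≤ ML κ Φ t p D (gT 0 (gxA c) κ Φ t p D) ∧
    64 * (nBR κ Φ t p D 0 + ℓBR κ Φ t p D 0 + (hBR κ Φ t p D 0).natAbs) ≤ ML κ Φ t p D (gT 0 (gxA c) κ Φ t p D) ∧
    64 * SF κ Φ t p D c 0 ≤ ML κ Φ t p D (gT 0 (gxA c) κ Φ t p D) ∧ 16 * SF κ Φ t p D c 0 ≤ ML κ Φ t p D (gT 0 (gxA c) κ Φ t p D) ∧
    22000 * (RA' κ Φ t p D 0 + 2) ≤ ML κ Φ t p D (gT 0 (gxA c) κ Φ t p D) := by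
  obtain ⟨-, h2, -, h4, -, -⟩ := ML_floorsT κ Φ t p D 0 (gxA c)
  have e : gxA c κ Φ t p D = max (max (64 * (nBR κ Φ t p D 0 + ℓBR κ Φ t p D 0 + (hBR κ Φ t p D 0).natAbs)) (64 * SF κ Φ t p D c 0)) (30000 * Neg.Kq κ * (RA' κ Φ t p D 0 + 2)) := rfl
  rw [e] at h4
  have a := le_trans (le_max_right _ _) h4
  have b := le_trans (le_trans (le_max_left _ _) (le_max_left _ _)) h4
  have d := le_trans (le_trans (le_max_right _ _) (le_max_left _ _)) h4
  exact ⟨a, b, d, by omega, h2⟩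

end Floors

end KS

end NegB

end PlanarSkeletonNeg

end Summit.CriticalPhenomena.PercolationContinuityZ3.Theorems.Transplant

end
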